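import Summits.QuantumFields.QCD.Theorems.PauliWegnerSeaOneScaleTrajectoryContentInLower
import Summits.QuantumFields.QCD.Theorems.PauliWegnerSeaOneScaleTrajectoryOfUpper
import Summits.QuantumFields.QCD.Theorems.ChiralGluonicCompletion.Negative.PinShape
import Summits.QuantumFields.QCD.Theorems.ChiralGluonicCompletion.Negative.ChiralThreshold
import Summits.QuantumFields.QCD.Theorems.RobustYangMillsHandover.Negative.ChiralityObstruction
import Summits.QuantumFields.QCD.Theorems.SpectralDefectExtinctionWindowExtinctionChessboardTransferFragments
import Literature.MathematicalPhysics.QuantumFieldTheory.QCDGoldstoneBound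
import Literature.MathematicalPhysics.QuantumFieldTheory.QCDPhaseQuenchedPositivity
import Literature.MathematicalPhysics.QuantumFieldTheory.QCDPhaseQuenchedMomentUpgrade

/-!
# Disproof of `ChiralOneScaleTrajectory` — findings (crux stmt-QuantumFields-17512, route PauliWegnerSea)

Standing disprover's work file (refuter-cdisprove-stmt-QuantumFields-17512-0, cycle 1, 2026-08-17).
Prose lives in docstrings; every `theorem` is kernel-checked (`lean check` rc 0, no `sorry`).

## VERDICT: resists — no kill is possible in the tree, and WHY (certified):
`not_iff` / `not_of_noChiralAFReg` / `not_qcdOf_of_noChiralAFReg` / `not_of_packageFailsAtEveryChiralReg`: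
a refutation is, for `N_f = 2` or `3`, EITHER "no asymptotically free mass-scaling regularisation is chiral at
zero" (which refutes the summit conjunct `QCDOf N_f` itself and needs a volume-uniform honest lattice gap —
pure-glue observables included — at every positive mass: Yang–Mills-hard) OR the no-go "every chiral AF
regularisation breaks (i) ∧ one-scale ∧ (iii) ∧ (iv) at some positive mass" (a statement about the
interacting weak-coupling phase-quenched measure; no finite computation certifies it).

## Index
* §0 `OneScale`, `Body`, `chiralOneScaleTrajectory_iff` — the crux re-read in the vocabulary of
  `Theorems/MobilityGap/Negative/LowerPin.lean` (`fm`, `bare`, `ClauseI`, `Lower`, `Sign`): `Iff.rfl`.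
* §1 STRUCTURE / KILL ROUTES: `oneScaleTrajectory_of` (drop the pin = stmt-11513), `chiralAFReg_of`,
  `not_iff`, the two kill routes above, `not_qcdOf_of_noChiralAFReg` (the pin-only kill kills `QCD`).
* §2 LOAD-BEARING ANALYSIS: the crux has exactly TWO honesty pins, (iii) LOWER and the pin `IsChiralAtZero`:
  `withoutLowerAndPin_holds` (landed `oneScaleTrajectory_without_lower_holds`: `heavyReg` inhabits both
  scalings + (i) + one-scale + (iv)), `withoutPin_iff_oneScaleTrajectory` (`Iff.rfl`), `body_window`
  ((iii) ⇒ `m_crit(k) < 1/10` eventually) — SHARPENED in the landed `Negative/CriticalMassLimsup.lean`: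
  (iii) ⇒ `m_f(k) < m₀` eventually for EVERY `m₀ > 0` and every flavour (one heavy flavour already decays at
  lattice rate at every exponent `s`), i.e. `limsup m_crit(k) ≤ 0`; with (i) the bare masses accumulate in `[−1,0]`, `WithoutLower` is `ChiralAFReg`-hard (`chiralAFReg_of_withoutLower`,
  `withoutLowerBody_heavyReg_iff_pin`: at `heavyReg` the ONLY missing conjunct is the pin, refutable only modulo
  the heavy-quark-plus-glue lattice gap `not_pin_heavyReg_of_gap`).
* §3 TIGHTNESS OF THE ONE-SCALE QUANTIFIERS (new, pure real analysis against (iii) and `β_k → ∞`):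
  `rpow_le_of_sandwich`, `shellDepth_lower_bound_rpow` / `shellDepth_lower_bound` — in any witness whose
  one-scale exponent is the exponent of (iii), `max C₁ 0 · K₀ > q − max p 0`: the shell scale MUST grow linearly
  in `q` (`∀ q ∃ K₀` does not commute; `body_shellDepth` at crux level), the rate constant `C₁` of (iii) MUST be
  positive (`C₁_pos`), and the log factor cannot be dropped (`not_oneScale_noLog`).  Lyapunov transfer between
  exponents: `fm_le_fm_rpow` (`fm(s') ≤ fm(s)^{s'/s}`, Jensen under the phase-quenched probability measure) and
  `shellDepth_lower_bound_of_exponent_le` — the same conclusions, up to the factor `s₂/s₁`, whenever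
  `s_one-scale ≥ s_(iii)`; a witness escapes them formally only with `s_one-scale < s_(iii)` (heavy tails).
  VOLUME (landed only, `Negative/VolumeGrowth.lean`): the same sandwich forces the shell to be LOG-DEEP and the
  physical volume SUPERLOGARITHMIC — `volume_lower_bound`: `∀ᶠ k, (q − p⁺) log(1/a_k) + log(c₀/2^{p⁺}) ≤ C₁⁺ (a_k L_k)`;
  `tendsto_volume_div_log`: one-scale at every `q` (common exponent) ⇒ `a_k L_k / log(1/a_k) → ∞` — the exact
  converse of the landed sufficiency `oneScale_of_upper`; so (iv) must be met at four-volumes `≫ (log 1/a_k)⁴`.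
* §4 THE PIN INSIDE THE ∃: up-shift transport of the whole package (`oneScale_mcritShift_iff`, …,
  `bodyMinusPin_mcritShift`), `body_mcritShift_iff_chiralAbove`, `packageForcesChirality_iff` /
  `not_packageForcesChirality_of` (why "package ⇒ chiral" cannot be a `∀ reg` item), pin shape inside T:
  `body_of_bodyMinusPin_of_gaplessPoint` / `_of_blowup` (T as typed is ALSO witnessed by a pin-free witness
  with ONE sign-blow-up tuple — T does not certify Goldstone physics; planner note), `not_body_of_uniformGap`.
* §5 HEREDITY: `bodyMinusPin_restrict` (everything but the pin passes to subsequences),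
  `body_restrict_of_goldstone` (with the Goldstone form of the pin the whole body does) — a diagonal /
  subsequence construction of a witness must prove the EVENTUAL Goldstone bound, not the typed pin.
* §6 WHY IT RESISTS / near-misses / what was tried (docblock at the end).

## LANDED (importable, namespace `Summit.QuantumFields.QCD.Theorems.ChiralOneScaleTrajectory.Negative`, all
`--supports stmt-QuantumFields-17512`, std axioms, definition-free):
* `…/Theorems/ChiralOneScaleTrajectory/Negative/ShellDepth.lean` (p135082, commit 72be9b43329e): `single_mem_box_of_le`,
  `rpow_le_of_sandwich`, `shellDepth_lower_bound_rpow`, `shellDepth_lower_bound`, `C₁_pos`, `not_oneScale_noLog`,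
  `shellDepth_of_hasAsymptoticScaling` (§3).
* `…/Negative/ShellDepthLyapunov.lean` (p135331, commit d74bc40e05b7): `fm_nonneg`, `fm_eq_expect`, `fm_le_fm_rpow`,
  `shellDepth_lower_bound_of_exponent_le` (§3, different exponents).
* `…/Negative/CriticalMassLimsup.lean` (p135572, commit d9cf85732e03): `norm_inv_diracMatrix_apply_le_single`,
  `fm_axis_le_of_heavy_flavour`, `eventually_bare_lt_of_lower`, `eventually_mcrit_lt_of_lower_pos`,
  `eventually_bare_mem_of_clauseI_lower` (§2, (iii) ⇒ limsup m_crit ≤ 0).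
* `…/Negative/VolumeGrowth.lean` (p135448, commit c58759f02cd8): `volume_lower_bound`, `tendsto_log_inv_a`,
  `tendsto_volume_div_log`, `tendsto_volume_div_log_of_hasAsymptoticScaling` (§3, necessity of superlog volume).
* `…/Negative/UpShift.lean` (p135172, commit 64f3c5ff379e): `bare_mcrit_shift`, `scheme_mcrit_shift`,
  `oneScale_mcrit_shift_iff`, `package_mcrit_shift_iff`, `bodyMinusPin_mcrit_shift`, `body_mcrit_shift_iff_chiralAbove`,
  `packageForcesChirality_iff`, `not_packageForcesChirality_of`, `packageMinimal_iff`, `not_packageMinimal_of_forall` (§4).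
* `…/Negative/PinHeredity.lean` (p135281, commit 093e2c961ff1): `bodyMinusPin_restrict`, `isChiralAtZero_restrict_iff`,
  `body_restrict_of_hasGoldstoneBound` (§5).
Ideators / planners / leads: import those modules rather than this work file.
-/

noncomputable section

namespace Summit.QuantumFields.QCD.Cruxes.ChiralOneScaleTrajectory.Disproof

open scoped BigOperators Topology
open MeasureTheory Filter Set
open Literature.MathematicalPhysics.QuantumFieldTheory Literature.MathematicalPhysics.QuantumLattice
  Literature.Probability.LatticeModels
open Summit.QuantumFields.QCD.Theorems.MobilityGapNegative
open Summit.QuantumFields.QCD.Theorems.OneScaleTrajectoryContent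
open Summit.QuantumFields.QCD.Theses.PauliWegnerSea (OneScaleTrajectory ChiralOneScaleTrajectory)

variable {Nf : ℕ}

/-! ### §0 The crux, clause by clause (definitional re-reading)

Reading notes (probe `W.lean`, rc 0; all junk conventions as recorded in `LowerPin.lean` §0 apply verbatim —
positive denominators `integral_norm_det_diracMatrix_pos_all`, `‖v‖ = ‖v‖∞` on `Site 4 = Fin 4 → ℤ`,
`Matrix.inv` total with weight `|det| = 0` at singular fields, `Real.rpow` with base `≥ 0`):
* the ONE-SCALE clause: `∀ q ∃ K₀ s ∀ᶠ k ∃ ℓ₀ ∈ [1, L_k]` with `ℓ₀ a_k ≤ K₀ (1 + |log a_k|)`, then for ALL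
  `S ≥ L_k`, flavours and ALL `v ∈ box S` with `‖v‖∞ = ℓ₀`: `ℓ₀^q (1+|β_k|)^q · fm ≤ 1`.  `K₀` is not asked
  positive but `ℓ₀ ≥ 1`, `a_k > 0` force `K₀ (1+|log a_k|) ≥ a_k > 0`; `q : ℕ` (so `q = 0` is the weak
  instance `fm ≤ 1` on one shell); the exponent `s` may depend on `q` and is INDEPENDENT of the `s` of (iii).
* the PIN `reg.IsChiralAtZero := ∀ ε > 0, ∃ m > 0 (tuple), ¬ (reg.scheme m 0 0).HasLatticeMassGap ε`
  (QCDOS.lean:644) — the SAME constant as in `QCDOf`; `¬ HasLatticeMassGap ε` unfolds to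
  `∃ A B ∀ C ∃ᶠ k ∃ S ≥ L_k ∃ n ≤ S, ‖corr_{k,S}(n)‖ > C e^{-ε a_k n}` (frequently in `k`, ONE torus per `k`).
* quantifier order: `∃ reg` BEFORE `∀ m`; the pin sits beside the scalings, outside `∀ m`.
-/

/-- The ONE-SCALE input of `(reg, m)` (clause text verbatim, through `fm`/`bare` of `LowerPin.lean`). -/
def OneScale (reg : QCDRegularisation Nf) (m : Fin Nf → ℝ) : Prop :=
  ∀ q : ℕ, ∃ K₀ s : ℝ, 0 < s ∧ s < 1 ∧ ∀ᶠ k in atTop, ∃ ℓ₀ : ℕ, 1 ≤ ℓ₀ ∧ ℓ₀ ≤ reg.L k ∧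
    (ℓ₀ : ℝ) * reg.a k ≤ K₀ * (1 + |Real.log (reg.a k)|) ∧ ∀ S : ℕ, reg.L k ≤ S →
      ∀ (f : Fin Nf) (v : Site 4), v ∈ box 4 S → ‖v‖ = (ℓ₀ : ℝ) →
        (ℓ₀ : ℝ) ^ q * (1 + |reg.β k|) ^ q * fm Nf (reg.β k) (bare reg m k) S f v s ≤ 1

/-- The per-mass package `(i) ∧ one-scale ∧ (iii) ∧ (iv)` of `(reg, m)`. -/
def Package (reg : QCDRegularisation Nf) (m : Fin Nf → ℝ) : Prop :=
  ClauseI reg m ∧ OneScale reg m ∧ Lower reg m ∧ Sign reg m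

/-- The body WITHOUT the pin (= the body of the legacy item `OneScaleTrajectory`, stmt-11513). -/
def BodyMinusPin (reg : QCDRegularisation Nf) : Prop :=
  reg.HasMassScaling ∧ (reg.scheme 0 0 0).HasAsymptoticScaling ∧
    ∀ m : Fin Nf → ℝ, (∀ f, 0 < m f) → Package reg m

/-- The body of the crux for ONE regularisation: both scalings, the PIN, the package at every `m > 0`. -/
def Body (reg : QCDRegularisation Nf) : Prop :=
  reg.HasMassScaling ∧ reg.IsChiralAtZero ∧ (reg.scheme 0 0 0).HasAsymptoticScaling ∧
    ∀ m : Fin Nf → ℝ, (∀ f, 0 < m f) → Package reg m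

/-- **The crux, re-read** (definitional): `ChiralOneScaleTrajectory ↔ ∀ N_f ∈ {2,3}, ∃ reg, Body reg`. -/
theorem chiralOneScaleTrajectory_iff :
    ChiralOneScaleTrajectory ↔ ∀ Nf : ℕ, Nf = 2 ∨ Nf = 3 → ∃ reg : QCDRegularisation Nf, Body reg :=
  Iff.rfl

/-- `Body = BodyMinusPin ∧ pin` (re-bracketing). -/
theorem body_iff (reg : QCDRegularisation Nf) : Body reg ↔ BodyMinusPin reg ∧ reg.IsChiralAtZero :=
  ⟨fun ⟨h1, h2, h3, h4⟩ => ⟨⟨h1, h3, h4⟩, h2⟩, fun ⟨⟨h1, h3, h4⟩, h2⟩ => ⟨h1, h2, h3, h4⟩⟩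

/-- The legacy item is `∀ N_f ∈ {2,3}, ∃ reg, BodyMinusPin reg` (definitional). -/
theorem oneScaleTrajectory_iff' :
    OneScaleTrajectory ↔ ∀ Nf : ℕ, Nf = 2 ∨ Nf = 3 → ∃ reg : QCDRegularisation Nf, BodyMinusPin reg :=
  Iff.rfl

/-! ### §1 Structure and kill routes -/

/-- Drop the pin: the crux implies the legacy item stmt-11513 (landed:
`oneScaleTrajectory_of_chiralOneScaleTrajectory`), so every negative finding on 11513 transfers. -/
theorem oneScaleTrajectory_of (h : ChiralOneScaleTrajectory) : OneScaleTrajectory :=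
  oneScaleTrajectory_of_chiralOneScaleTrajectory h

variable (Nf) in
/-- "Some asymptotically free, mass-scaling regularisation is chiral at zero" — the residue of the crux when
the whole per-mass package is dropped (the `ChiralAFReg` of `Cruxes/ChiralGluonicCompletion/Disproof.lean`). -/
def ChiralAFReg : Prop :=
  ∃ reg : QCDRegularisation Nf, reg.HasMassScaling ∧ reg.IsChiralAtZero ∧ (reg.scheme 0 0 0).HasAsymptoticScaling

/-- The crux supplies a chiral AF regularisation at both flavour numbers. -/
theorem chiralAFReg_of (h : ChiralOneScaleTrajectory) {Nf : ℕ} (hNf : Nf = 2 ∨ Nf = 3) :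
    ChiralAFReg Nf := by
  obtain ⟨reg, hMS, hch, hAS, -⟩ := h Nf hNf
  exact ⟨reg, hMS, hch, hAS⟩

/-- So does the summit conjunct `QCDOf N_f` (for `N_f ≥ 1`... indeed for every `N_f`: the positive tuple
`m ≡ 1` exists in all cases, vacuously constrained at `N_f = 0`). -/
theorem chiralAFReg_of_qcdOf (h : QCDOf Nf) : ChiralAFReg Nf := by
  obtain ⟨reg, hMS, hch, hm⟩ := h
  obtain ⟨z, shift, T, ⟨hAS, -⟩, -⟩ := hm (fun _ => 1) (fun _ => one_pos)
  obtain ⟨Λ, hΛ, hT⟩ := hAS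
  exact ⟨reg, hMS, hch, Λ, hΛ, hT⟩

/-- **What a refutation must contain**: `¬ crux ↔` for `N_f = 2` or `N_f = 3`, NO regularisation has the body. -/
theorem not_iff : ¬ ChiralOneScaleTrajectory ↔
    (∀ reg : QCDRegularisation 2, ¬ Body reg) ∨ (∀ reg : QCDRegularisation 3, ¬ Body reg) := by
  rw [chiralOneScaleTrajectory_iff]
  constructor
  · intro h
    by_contra hc
    push Not at hc
    obtain ⟨⟨r2, h2⟩, ⟨r3, h3⟩⟩ := hc
    exact h fun Nf hNf => by
      rcases hNf with rfl | rfl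
      exacts [⟨r2, h2⟩, ⟨r3, h3⟩]
  · rintro (h | h) hc
    · obtain ⟨reg, hreg⟩ := hc 2 (Or.inl rfl); exact h reg hreg
    · obtain ⟨reg, hreg⟩ := hc 3 (Or.inr rfl); exact h reg hreg

/-- KILL ROUTE 1 (through the pin alone): if no AF mass-scaling regularisation of `N_f`-flavour lattice QCD
is chiral at zero (`N_f ∈ {2,3}`), the crux is false … -/
theorem not_of_noChiralAFReg {Nf : ℕ} (hNf : Nf = 2 ∨ Nf = 3) (h : ¬ ChiralAFReg Nf) :
    ¬ ChiralOneScaleTrajectory := fun hc => h (chiralAFReg_of hc hNf)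

/-- … but then so is the summit conjunct `QCDOf N_f` (hence `QCD`): kill route 1 is a disproof of the
Millennium-grade statement, not of this route.  By `not_isChiralAtZero_iff_uniformLatticeGap` its content is a
volume-uniform honest lattice gap at ONE rate for EVERY positive mass tuple of EVERY such regularisation —
glueball channels included (Yang–Mills-hard) and physically false if massless two-flavour QCD has pions. -/
theorem not_qcdOf_of_noChiralAFReg (h : ¬ ChiralAFReg Nf) : ¬ QCDOf Nf := fun hq => h (chiralAFReg_of_qcdOf hq)

/-- Kill route 1, unfolded: "no chiral AF regularisation" IS "every AF mass-scaling regularisation is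
uniformly gapped at some rate at all positive masses". -/
theorem noChiralAFReg_iff : ¬ ChiralAFReg Nf ↔ ∀ reg : QCDRegularisation Nf, reg.HasMassScaling →
    (reg.scheme 0 0 0).HasAsymptoticScaling →
      ∃ ε > (0 : ℝ), ∀ m : Fin Nf → ℝ, (∀ f, 0 < m f) → (reg.scheme m 0 0).HasLatticeMassGap ε := by
  simp only [ChiralAFReg, not_exists, not_and]
  refine forall_congr' fun reg => ⟨fun h hMS hAS => ?_, fun h hMS hch hAS => ?_⟩
  · exact (Summit.QuantumFields.QCD.Theorems.RobustYangMillsHandover.Negative.not_isChiralAtZero_iff_uniformLatticeGap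
      reg).1 fun hch => h hMS hch hAS
  · exact (Summit.QuantumFields.QCD.Theorems.RobustYangMillsHandover.Negative.not_isChiralAtZero_iff_uniformLatticeGap
      reg).2 (h hMS hAS) hch

/-- KILL ROUTE 2 (through the package at chiral regularisations): if every chiral AF mass-scaling
regularisation of `N_f`-flavour lattice QCD (`N_f ∈ {2,3}`) breaks the package at some positive tuple, the crux
is false.  This is the route text's kill criterion "localisation at a physical rate holds only strictly above the
chiral line" made formal: its content is a no-go about the interacting phase-quenched measure AT the approach
to the witness's own critical line, for ALL admissible `m_crit(k)`, `β_k`, `L_k` — not certifiable by any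
finite computation, and without a printed counterpart (Golterman–Shamir–Svetitsky report a mobility edge
reaching zero only AT the Aoki boundary, with localised in-gap modes outside). -/
theorem not_of_packageFailsAtEveryChiralReg {Nf : ℕ} (hNf : Nf = 2 ∨ Nf = 3)
    (h : ∀ reg : QCDRegularisation Nf, reg.HasMassScaling → reg.IsChiralAtZero →
      (reg.scheme 0 0 0).HasAsymptoticScaling → ∃ m : Fin Nf → ℝ, (∀ f, 0 < m f) ∧ ¬ Package reg m) :
    ¬ ChiralOneScaleTrajectory := by
  intro hc
  obtain ⟨reg, hMS, hch, hAS, hP⟩ := hc Nf hNf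
  obtain ⟨m, hm, hnP⟩ := h reg hMS hch hAS
  exact hnP (hP m hm)

/-- The two routes are exhaustive: `¬ Body reg` for every `reg` splits as (no pin) ∨ (package fails). -/
theorem not_body_iff (reg : QCDRegularisation Nf) : ¬ Body reg ↔
    (reg.HasMassScaling → (reg.scheme 0 0 0).HasAsymptoticScaling → reg.IsChiralAtZero →
      ∃ m : Fin Nf → ℝ, (∀ f, 0 < m f) ∧ ¬ Package reg m) := by
  simp only [Body, not_and, not_forall, exists_prop]
  exact ⟨fun h hMS hAS hch => h hMS hch hAS, fun h hMS hch hAS => h hMS hAS hch⟩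

/-! ### §2 Load-bearing analysis: the two honesty pins are (iii) LOWER and the pin -/

/-- **(a) Both honesty pins dropped ⇒ PROVABLE today** (landed `oneScaleTrajectory_without_lower_holds`, witness
`heavyReg`: `m_crit ≡ 1`, one-scale by the hopping bound at the shell `ℓ₀ = k+1`, (iv) by Seiler positivity). -/
theorem withoutLowerAndPin_holds :
    ∀ Nf : ℕ, Nf = 2 ∨ Nf = 3 → ∃ reg : QCDRegularisation Nf,
      reg.HasMassScaling ∧ (reg.scheme 0 0 0).HasAsymptoticScaling ∧
        ∀ m : Fin Nf → ℝ, (∀ f, 0 < m f) → ClauseI reg m ∧ OneScale reg m ∧ Sign reg m :=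
  oneScaleTrajectory_without_lower_holds

/-- **(b) Pin dropped ⇒ the legacy item** `OneScaleTrajectory` (stmt-11513, open; (iii) its sole honesty pin). -/
theorem withoutPin_iff_oneScaleTrajectory :
    (∀ Nf : ℕ, Nf = 2 ∨ Nf = 3 → ∃ reg : QCDRegularisation Nf, BodyMinusPin reg) ↔ OneScaleTrajectory :=
  Iff.rfl

/-- **(c) (iii) kept ⇒ bare-mass window**: every regularisation with the body keeps all its realised bare
masses in `|m_f(k) + 4| < 41/10` and has `m_crit(k) < 1/10` eventually (landed `LowerPin`). With the pin this
reads: the critical line the pin locates is approached from the LIGHT side, never from the hopping region. -/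
theorem body_window {reg : QCDRegularisation Nf} (h : Body reg) (m : Fin Nf → ℝ) (hm : ∀ f, 0 < m f)
    (f : Fin Nf) :
    (∀ᶠ k in atTop, |reg.mcrit k + reg.a k * m f / reg.Zm k + 4| < 41 / 10) ∧
      (∀ᶠ k in atTop, reg.mcrit k < 1 / 10) :=
  ⟨eventually_window_of_lower reg m (h.2.2.2 m hm).2.2.1 f,
    eventually_mcrit_lt_of_lower reg m hm (h.2.2.2 m hm).2.2.1 f⟩

/-- The body with clause (iii) deleted but the PIN kept. -/
def WithoutLowerBody (reg : QCDRegularisation Nf) : Prop :=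
  reg.HasMassScaling ∧ reg.IsChiralAtZero ∧ (reg.scheme 0 0 0).HasAsymptoticScaling ∧
    ∀ m : Fin Nf → ℝ, (∀ f, 0 < m f) → ClauseI reg m ∧ OneScale reg m ∧ Sign reg m

/-- **(d) (iii) dropped, pin kept ⇒ still `ChiralAFReg`-hard**: unlike `MobilityGap`/`OneScaleTrajectory`, the
chiral crux is NOT junk-inhabited once (iii) is deleted — the residue contains a chiral AF regularisation. -/
theorem chiralAFReg_of_withoutLower {reg : QCDRegularisation Nf} (h : WithoutLowerBody reg) : ChiralAFReg Nf :=
  ⟨reg, h.1, h.2.1, h.2.2.1⟩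

/-- At the lattice-heavy junk witness `heavyReg` the ONLY missing conjunct of `WithoutLowerBody` is the pin. -/
theorem withoutLowerBody_heavyReg_iff_pin : WithoutLowerBody (heavyReg Nf) ↔ (heavyReg Nf).IsChiralAtZero := by
  refine ⟨fun h => h.2.1, fun hch => ⟨heavyReg_hasMassScaling, hch, heavyReg_hasAsymptoticScaling, fun m hm => ?_⟩⟩
  refine ⟨fun f => Eventually.of_forall fun k => by linarith [(heavyReg_bare_window m hm k f).1],
    heavyReg_oneScale m hm, Eventually.of_forall fun k => ?_⟩
  rw [signRatio_eq_one_of_pos ((heavyReg Nf).β k) (bare (heavyReg Nf) m k)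
    fun f => by linarith [(heavyReg_bare_window m hm k f).1]]
  norm_num

/-- … and that conjunct is refutable only MODULO a uniform honest lattice gap of heavy-quark lattice QCD
(`H := ∃ ε > 0, ∀ m > 0, (heavyReg.scheme m 0 0).HasLatticeMassGap ε` — quark channels by the hopping
expansion, but ALSO every Wilson-loop channel at `β_k → ∞`: the lattice Yang–Mills gap; not in the tree). -/
theorem not_pin_heavyReg_of_gap
    (H : ∃ ε > (0 : ℝ), ∀ m : Fin Nf → ℝ, (∀ f, 0 < m f) → ((heavyReg Nf).scheme m 0 0).HasLatticeMassGap ε) :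
    ¬ (heavyReg Nf).IsChiralAtZero :=
  (Summit.QuantumFields.QCD.Theorems.RobustYangMillsHandover.Negative.not_isChiralAtZero_iff_uniformLatticeGap _).2 H

/-- Both witnesses of junk type are dead: `heavyReg` fails (iii) outright (`heavyReg_not_lower`), hence the body. -/
theorem not_body_heavyReg (hNf : 0 < Nf) : ¬ Body (heavyReg Nf) := fun h =>
  heavyReg_not_lower hNf (fun _ => 1) (fun _ => one_pos) (h.2.2.2 _ fun _ => one_pos).2.2.1


/-! ### §3 Tightness of the one-scale quantifiers (pure real analysis against (iii) and `β_k → ∞`)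

In the FM literature the a-priori fractional-moment bound and the lower bound are statements about ONE
exponent `s` (any small `s`); the crux lets the one-scale exponent depend on `q` and be unrelated to the
exponent of (iii).  For a COMMON exponent (and, by the Lyapunov transfer `fm_mono_exponent` below, whenever
`s_one-scale ≥ s_(iii)`) the two clauses meet on the time axis at the shell point `v = ℓ₀ e₀` of the
scheme's own torus `S = L_k`, and elementary bookkeeping gives:

* `shellDepth_lower_bound`: `max C₁ 0 · K₀ > q − max p 0` — the admissible shell scale grows at least
  LINEARLY in the demanded power `q` (so `∀ q ∃ K₀` cannot be commuted to `∃ K₀ ∀ q`, and once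
  `FMClosureUnquenched` fixes the power `q₀` it needs, the restated trajectory item must carry
  `K₀ ≥ (q₀ − p)/C₁`: the one-scale input is consumed at depth `≍ (q₀/C₁) · log(1/a_k)/a_k`);
* `C₁_pos`: the rate constant of (iii) is POSITIVE in every such witness (a rate-free lower bound
  `c₀ (n+1)^{-p}` is incompatible with the one-scale decay beyond power `p`);
* `not_oneScale_noLog`: with the log factor deleted (`ℓ₀ a_k ≤ K₀`) the one-scale clause is incompatible
  with (iii) at the single power `q = ⌈max p 1⌉` — the log room is necessary (re-derivation of the 11513
  disprover's "log room" lemma, whose file is evidence-only).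

All three need only `β_k → +∞`, which two-loop asymptotic scaling gives for `N_f ≤ 16`
(`tendsto_beta_atTop_of_hasAsymptoticScaling`, landed).
-/

/-- `ℓ₀ e₀ ∈ box S` for `ℓ₀ ≤ S`. -/
theorem single_mem_box_of_le {ℓ₀ S : ℕ} (h : ℓ₀ ≤ S) : (Pi.single 0 (ℓ₀ : ℤ) : Site 4) ∈ box 4 S := by
  rw [mem_box]
  intro i
  by_cases hi : i = 0
  · subst hi
    simp only [Pi.single_eq_same]
    exact ⟨by omega, by exact_mod_cast h⟩
  · simp [Pi.single_eq_of_ne hi]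

/-- **Pointwise bookkeeping.** From the lower bound `c₀ e^{-(C₁ aℓ + p log(ℓ+1))} ≤ F` and the one-scale
bound `ℓ^r B^r F ≤ 1` (`ℓ ≥ 1`, `B ≥ 0`, `a > 0`, real power `r`):
`B^r ≤ 2^{p⁺} e^{C₁⁺ a ℓ} ℓ^{p⁺ - r} / c₀` (`x⁺ = max x 0`). -/
theorem rpow_le_of_sandwich {c₀ C₁ p a ℓ B F r : ℝ} (hc₀ : 0 < c₀) (ha : 0 < a) (hℓ : 1 ≤ ℓ)
    (hB : 0 ≤ B) (h1 : c₀ * Real.exp (-(C₁ * (a * ℓ) + p * Real.log (ℓ + 1))) ≤ F)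
    (h2 : ℓ ^ r * B ^ r * F ≤ 1) :
    B ^ r ≤ (2 : ℝ) ^ max p 0 * Real.exp (max C₁ 0 * (a * ℓ)) * ℓ ^ (max p 0 - r) / c₀ := by
  have hℓ0 : 0 < ℓ := by linarith
  have hℓ1 : 0 < ℓ + 1 := by linarith
  set E : ℝ := C₁ * (a * ℓ) + p * Real.log (ℓ + 1) with hE
  have hℓr : 0 < ℓ ^ r := Real.rpow_pos_of_pos hℓ0 r
  have hBr : 0 ≤ B ^ r := Real.rpow_nonneg hB r
  -- `c₀ e^{-E} ℓ^r B^r ≤ 1`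
  have h3 : c₀ * Real.exp (-E) * (ℓ ^ r * B ^ r) ≤ 1 := by
    have := mul_le_mul_of_nonneg_left h1 (mul_nonneg hℓr.le hBr)
    calc c₀ * Real.exp (-E) * (ℓ ^ r * B ^ r) = ℓ ^ r * B ^ r * (c₀ * Real.exp (-E)) := by ring
      _ ≤ ℓ ^ r * B ^ r * F := this
      _ ≤ 1 := h2
  -- hence `B^r ≤ e^{E} / (c₀ ℓ^r)`
  have h4 : B ^ r ≤ Real.exp E / (c₀ * ℓ ^ r) := by
    rw [le_div_iff₀ (by positivity)]
    have e1 : Real.exp E * (c₀ * Real.exp (-E) * (ℓ ^ r * B ^ r)) = B ^ r * (c₀ * ℓ ^ r) := by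
      have : Real.exp E * Real.exp (-E) = 1 := by rw [← Real.exp_add, add_neg_cancel, Real.exp_zero]
      calc Real.exp E * (c₀ * Real.exp (-E) * (ℓ ^ r * B ^ r))
          = (Real.exp E * Real.exp (-E)) * (B ^ r * (c₀ * ℓ ^ r)) := by ring
        _ = _ := by rw [this, one_mul]
    have := mul_le_mul_of_nonneg_left h3 (Real.exp_pos E).le
    rwa [e1, mul_one] at this
  -- bound `e^{E} ≤ e^{C⁺ a ℓ} (2ℓ)^{p⁺} = e^{C⁺ a ℓ} 2^{p⁺} ℓ^{p⁺}`
  have hE1 : Real.exp E ≤ Real.exp (max C₁ 0 * (a * ℓ)) * ((2 : ℝ) ^ max p 0 * ℓ ^ max p 0) := by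
    have haℓ : 0 ≤ a * ℓ := by positivity
    rw [hE, Real.exp_add]
    refine mul_le_mul ?_ ?_ (Real.exp_pos _).le (Real.exp_pos _).le
    · exact Real.exp_le_exp.2 (mul_le_mul_of_nonneg_right (le_max_left _ _) haℓ)
    · have e2 : Real.exp (p * Real.log (ℓ + 1)) = (ℓ + 1) ^ p := by
        rw [Real.rpow_def_of_pos hℓ1, mul_comm]
      rw [e2, ← Real.mul_rpow (by norm_num) hℓ0.le]
      calc (ℓ + 1) ^ p ≤ (ℓ + 1) ^ max p 0 :=
            Real.rpow_le_rpow_of_exponent_le (by linarith) (le_max_left _ _)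
        _ ≤ (2 * ℓ) ^ max p 0 := Real.rpow_le_rpow hℓ1.le (by linarith) (le_max_right _ _)
  -- assemble
  calc B ^ r ≤ Real.exp E / (c₀ * ℓ ^ r) := h4
    _ ≤ Real.exp (max C₁ 0 * (a * ℓ)) * ((2 : ℝ) ^ max p 0 * ℓ ^ max p 0) / (c₀ * ℓ ^ r) :=
        div_le_div_of_nonneg_right hE1 (by positivity)
    _ = (2 : ℝ) ^ max p 0 * Real.exp (max C₁ 0 * (a * ℓ)) * ℓ ^ (max p 0 - r) / c₀ := by
        rw [Real.rpow_sub hℓ0]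
        field_simp

/-- **Shell depth lower bound (common exponent, real power `r ≥ 1`).** Along a regularisation with
`β_k → +∞`, if the matrix of (iii) holds with data `(s, c₀, C₁, p)` and the one-scale matrix holds at power `r ≥ 1`
with shell budget `K₀` and the SAME exponent `s`, then `max C₁ 0 · K₀ > r − max p 0`.  (Proof: at the shell point
`ℓ₀ e₀` of the torus `S = L_k`, `rpow_le_of_sandwich` gives `(1+|β_k|)^r ≤ 2^{p⁺} e^{C₁⁺ a_k ℓ₀} ℓ₀^{p⁺-r}/c₀`; if
`C₁⁺ K₀ ≤ r − p⁺` the right side is `≤ 2^{p⁺} e^{C₁⁺(1+K₀)}/c₀` in both regimes `a_k ℓ₀ ≤ 1` (`ℓ₀^{p⁺-r} ≤ 1`)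
and `a_k ℓ₀ > 1` (`e^{C₁⁺ a_k ℓ₀} ℓ₀^{p⁺-r} ≤ e^{C₁⁺K₀} a_k^{r-p⁺-C₁⁺K₀} ≤ e^{C₁⁺K₀}`), contradicting `β_k → ∞`.) -/
theorem shellDepth_lower_bound_rpow (reg : QCDRegularisation Nf) (m : Fin Nf → ℝ)
    (hβ : Tendsto reg.β atTop atTop) (f : Fin Nf) {s c₀ C₁ p K₀ r : ℝ} (hr : 1 ≤ r) (hc₀ : 0 < c₀)
    (hL : ∀ᶠ k in atTop, ∀ S : ℕ, reg.L k ≤ S → ∀ (f : Fin Nf) (n : ℕ), n ≤ S →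
      c₀ * Real.exp (-(C₁ * (reg.a k * n) + p * Real.log (n + 1))) ≤
        fm Nf (reg.β k) (bare reg m k) S f (Pi.single 0 (n : ℤ)) s)
    (hO : ∀ᶠ k in atTop, ∃ ℓ₀ : ℕ, 1 ≤ ℓ₀ ∧ ℓ₀ ≤ reg.L k ∧
      (ℓ₀ : ℝ) * reg.a k ≤ K₀ * (1 + |Real.log (reg.a k)|) ∧ ∀ S : ℕ, reg.L k ≤ S →
        ∀ (f : Fin Nf) (v : Site 4), v ∈ box 4 S → ‖v‖ = (ℓ₀ : ℝ) →
          (ℓ₀ : ℝ) ^ r * (1 + |reg.β k|) ^ r * fm Nf (reg.β k) (bare reg m k) S f v s ≤ 1) :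
    r - max p 0 < max C₁ 0 * K₀ := by
  by_contra hK
  push Not at hK
  set P : ℝ := max p 0 with hP
  set C : ℝ := max C₁ 0 with hC
  have hP0 : 0 ≤ P := le_max_right _ _
  have hC0 : 0 ≤ C := le_max_right _ _
  -- the bound that will contradict `β_k → ∞`
  set M : ℝ := (2 : ℝ) ^ P * Real.exp (C * (1 + |K₀|)) / c₀ with hM
  have ha1 : ∀ᶠ k in atTop, reg.a k ≤ 1 := reg.tendsto_a.eventually (eventually_le_nhds one_pos)
  have hbig : ∀ᶠ k in atTop, M < reg.β k := hβ.eventually_gt_atTop M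
  obtain ⟨k, ⟨⟨⟨hLk, ⟨ℓ₀, hℓ1, hℓL, hℓa, hOk⟩⟩, hak⟩, hβk⟩⟩ := (((hL.and hO).and ha1).and hbig).exists
  have ha := reg.a_pos k
  have hℓ : (1 : ℝ) ≤ ℓ₀ := by exact_mod_cast hℓ1
  have hℓ0 : (0 : ℝ) < ℓ₀ := by linarith
  -- `K₀ > 0` is forced by `0 < ℓ₀ a_k ≤ K₀ (1 + |log a_k|)`
  have hlog1 : 0 < 1 + |Real.log (reg.a k)| := by positivity
  have hK₀ : 0 < K₀ := by
    have : 0 < K₀ * (1 + |Real.log (reg.a k)|) := lt_of_lt_of_le (by positivity) hℓa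
    exact pos_of_mul_pos_left this hlog1.le
  have hKabs : |K₀| = K₀ := abs_of_pos hK₀
  -- the two clause instances at the shell point of the torus `S = L_k`
  have h1 := hLk (reg.L k) le_rfl f ℓ₀ hℓL
  have h2 := hOk (reg.L k) le_rfl f (Pi.single 0 (ℓ₀ : ℤ)) (single_mem_box_of_le hℓL)
    (norm_single_natCast ℓ₀)
  have hB : (0 : ℝ) ≤ 1 + |reg.β k| := by positivity
  have h3 := rpow_le_of_sandwich hc₀ ha hℓ hB h1 h2
  -- bound the right-hand side by `M` in both regimes
  have hqP : P - r ≤ 0 := by nlinarith [mul_nonneg hC0 hK₀.le]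
  have hmain : Real.exp (C * (reg.a k * ℓ₀)) * (ℓ₀ : ℝ) ^ (P - r) ≤ Real.exp (C * (1 + |K₀|)) := by
    rw [hKabs]
    by_cases hx : reg.a k * ℓ₀ ≤ 1
    · -- shallow shell: `e^{C x} ≤ e^{C}`, `ℓ₀^{P-r} ≤ 1`
      have e1 : Real.exp (C * (reg.a k * ℓ₀)) ≤ Real.exp (C * (1 + K₀)) :=
        Real.exp_le_exp.2 (mul_le_mul_of_nonneg_left (by linarith) hC0)
      have e2 : (ℓ₀ : ℝ) ^ (P - r) ≤ 1 := Real.rpow_le_one_of_one_le_of_nonpos hℓ hqP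
      calc Real.exp (C * (reg.a k * ℓ₀)) * (ℓ₀ : ℝ) ^ (P - r)
          ≤ Real.exp (C * (1 + K₀)) * 1 := mul_le_mul e1 e2 (by positivity) (Real.exp_pos _).le
        _ = _ := mul_one _
    · -- deep shell: `ℓ₀ ≥ 1/a_k`, `e^{C x} ≤ e^{C K₀} a_k^{-C K₀}`, `ℓ₀^{P-r} ≤ a_k^{r-P}`
      push Not at hx
      have hxK : reg.a k * ℓ₀ ≤ K₀ * (1 + |Real.log (reg.a k)|) := by rw [mul_comm]; exact hℓa
      have hloga : |Real.log (reg.a k)| = -Real.log (reg.a k) :=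
        abs_of_nonpos (Real.log_nonpos ha.le hak)
      have e1 : Real.exp (C * (reg.a k * ℓ₀)) ≤ Real.exp (C * K₀) * reg.a k ^ (-(C * K₀)) := by
        have : Real.exp (C * (reg.a k * ℓ₀)) ≤ Real.exp (C * (K₀ * (1 + |Real.log (reg.a k)|))) :=
          Real.exp_le_exp.2 (mul_le_mul_of_nonneg_left hxK hC0)
        refine this.trans (le_of_eq ?_)
        rw [hloga, Real.rpow_def_of_pos ha, ← Real.exp_add]
        congr 1; ring
      have e2 : (ℓ₀ : ℝ) ^ (P - r) ≤ reg.a k ^ (-(P - r)) := by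
        have hinv : (reg.a k)⁻¹ ≤ ℓ₀ := by
          rw [inv_le_iff_one_le_mul₀ ha, mul_comm]; exact hx.le
        calc (ℓ₀ : ℝ) ^ (P - r) ≤ (reg.a k)⁻¹ ^ (P - r) :=
              Real.rpow_le_rpow_of_nonpos (inv_pos.2 ha) hinv hqP
          _ = reg.a k ^ (-(P - r)) := by rw [Real.inv_rpow ha.le, ← Real.rpow_neg ha.le]
      have e3 : reg.a k ^ (-(C * K₀)) * reg.a k ^ (-(P - r)) ≤ 1 := by
        rw [← Real.rpow_add ha]
        exact Real.rpow_le_one ha.le hak (by linarith)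
      calc Real.exp (C * (reg.a k * ℓ₀)) * (ℓ₀ : ℝ) ^ (P - r)
          ≤ (Real.exp (C * K₀) * reg.a k ^ (-(C * K₀))) * reg.a k ^ (-(P - r)) :=
            mul_le_mul e1 e2 (Real.rpow_nonneg hℓ0.le _) (by positivity)
        _ = Real.exp (C * K₀) * (reg.a k ^ (-(C * K₀)) * reg.a k ^ (-(P - r))) := by ring
        _ ≤ Real.exp (C * K₀) * 1 := mul_le_mul_of_nonneg_left e3 (Real.exp_pos _).le
        _ ≤ Real.exp (C * (1 + K₀)) := by
            rw [mul_one]; exact Real.exp_le_exp.2 (by nlinarith)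
  have h4 : (1 + |reg.β k|) ^ r ≤ M := by
    calc (1 + |reg.β k|) ^ r ≤ (2 : ℝ) ^ P * Real.exp (C * (reg.a k * ℓ₀)) * (ℓ₀ : ℝ) ^ (P - r) / c₀ := h3
      _ = (2 : ℝ) ^ P * (Real.exp (C * (reg.a k * ℓ₀)) * (ℓ₀ : ℝ) ^ (P - r)) / c₀ := by ring
      _ ≤ (2 : ℝ) ^ P * Real.exp (C * (1 + |K₀|)) / c₀ :=
          div_le_div_of_nonneg_right (mul_le_mul_of_nonneg_left hmain (by positivity)) hc₀.le
  -- contradiction with `β_k > M`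
  have h5 : reg.β k ≤ (1 + |reg.β k|) ^ r :=
    calc reg.β k ≤ 1 + |reg.β k| := by linarith [le_abs_self (reg.β k)]
      _ ≤ (1 + |reg.β k|) ^ r := Real.self_le_rpow_of_one_le (by linarith [abs_nonneg (reg.β k)]) hr
  linarith

/-- **Shell depth lower bound** for the clause as typed (natural power `q ≥ 1`, common exponent):
`max C₁ 0 · K₀ > q − max p 0`. -/
theorem shellDepth_lower_bound (reg : QCDRegularisation Nf) (m : Fin Nf → ℝ)
    (hβ : Tendsto reg.β atTop atTop) (f : Fin Nf) {s c₀ C₁ p K₀ : ℝ} {q : ℕ} (hq : 1 ≤ q) (hc₀ : 0 < c₀)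
    (hL : ∀ᶠ k in atTop, ∀ S : ℕ, reg.L k ≤ S → ∀ (f : Fin Nf) (n : ℕ), n ≤ S →
      c₀ * Real.exp (-(C₁ * (reg.a k * n) + p * Real.log (n + 1))) ≤
        fm Nf (reg.β k) (bare reg m k) S f (Pi.single 0 (n : ℤ)) s)
    (hO : ∀ᶠ k in atTop, ∃ ℓ₀ : ℕ, 1 ≤ ℓ₀ ∧ ℓ₀ ≤ reg.L k ∧
      (ℓ₀ : ℝ) * reg.a k ≤ K₀ * (1 + |Real.log (reg.a k)|) ∧ ∀ S : ℕ, reg.L k ≤ S →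
        ∀ (f : Fin Nf) (v : Site 4), v ∈ box 4 S → ‖v‖ = (ℓ₀ : ℝ) →
          (ℓ₀ : ℝ) ^ q * (1 + |reg.β k|) ^ q * fm Nf (reg.β k) (bare reg m k) S f v s ≤ 1) :
    (q : ℝ) - max p 0 < max C₁ 0 * K₀ := by
  refine shellDepth_lower_bound_rpow reg m hβ f (r := q) (by exact_mod_cast hq) hc₀ hL ?_
  refine hO.mono fun k ⟨ℓ₀, h1, h2, h3, h4⟩ => ⟨ℓ₀, h1, h2, h3, fun S hS f v hv hn => ?_⟩
  rw [Real.rpow_natCast, Real.rpow_natCast]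
  exact h4 S hS f v hv hn

/-- **The rate constant of (iii) is positive** in every such witness: if `C₁ ≤ 0`, the one-scale matrix
fails at every power `q > max p 0` for every budget `K₀` (common exponent). -/
theorem C₁_pos (reg : QCDRegularisation Nf) (m : Fin Nf → ℝ) (hβ : Tendsto reg.β atTop atTop)
    (f : Fin Nf) {s c₀ C₁ p K₀ : ℝ} {q : ℕ} (hq : 1 ≤ q) (hqp : max p 0 < q) (hc₀ : 0 < c₀)
    (hL : ∀ᶠ k in atTop, ∀ S : ℕ, reg.L k ≤ S → ∀ (f : Fin Nf) (n : ℕ), n ≤ S →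
      c₀ * Real.exp (-(C₁ * (reg.a k * n) + p * Real.log (n + 1))) ≤
        fm Nf (reg.β k) (bare reg m k) S f (Pi.single 0 (n : ℤ)) s)
    (hO : ∀ᶠ k in atTop, ∃ ℓ₀ : ℕ, 1 ≤ ℓ₀ ∧ ℓ₀ ≤ reg.L k ∧
      (ℓ₀ : ℝ) * reg.a k ≤ K₀ * (1 + |Real.log (reg.a k)|) ∧ ∀ S : ℕ, reg.L k ≤ S →
        ∀ (f : Fin Nf) (v : Site 4), v ∈ box 4 S → ‖v‖ = (ℓ₀ : ℝ) →
          (ℓ₀ : ℝ) ^ q * (1 + |reg.β k|) ^ q * fm Nf (reg.β k) (bare reg m k) S f v s ≤ 1) :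
    0 < C₁ := by
  have h := shellDepth_lower_bound reg m hβ f hq hc₀ hL hO
  by_contra hC
  push Not at hC
  rw [max_eq_right hC, zero_mul] at h
  linarith

/-- **The log room is necessary.** With the log factor deleted from the shell constraint (`ℓ₀ a_k ≤ K₀`), the
one-scale matrix at any power `q ≥ max p 1` (common exponent) contradicts (iii) along every regularisation
with `β_k → +∞`: the shell is then at bounded physical depth, where (iii) keeps `fm ≥ c₀ e^{-C₁⁺K₀}(ℓ₀+1)^{-p}`,
while one-scale wants `fm ≤ ℓ₀^{-q} (1+|β_k|)^{-q} → 0`. -/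
theorem not_oneScale_noLog (reg : QCDRegularisation Nf) (m : Fin Nf → ℝ) (hβ : Tendsto reg.β atTop atTop)
    (f : Fin Nf) {s c₀ C₁ p : ℝ} {q : ℕ} (hq : 1 ≤ q) (hqp : max p 0 ≤ q) (hc₀ : 0 < c₀)
    (hL : ∀ᶠ k in atTop, ∀ S : ℕ, reg.L k ≤ S → ∀ (f : Fin Nf) (n : ℕ), n ≤ S →
      c₀ * Real.exp (-(C₁ * (reg.a k * n) + p * Real.log (n + 1))) ≤
        fm Nf (reg.β k) (bare reg m k) S f (Pi.single 0 (n : ℤ)) s) (K₀ : ℝ) :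
    ¬ (∀ᶠ k in atTop, ∃ ℓ₀ : ℕ, 1 ≤ ℓ₀ ∧ ℓ₀ ≤ reg.L k ∧ (ℓ₀ : ℝ) * reg.a k ≤ K₀ ∧
      ∀ S : ℕ, reg.L k ≤ S → ∀ (f : Fin Nf) (v : Site 4), v ∈ box 4 S → ‖v‖ = (ℓ₀ : ℝ) →
        (ℓ₀ : ℝ) ^ q * (1 + |reg.β k|) ^ q * fm Nf (reg.β k) (bare reg m k) S f v s ≤ 1) := by
  intro hO
  set P : ℝ := max p 0 with hP
  set C : ℝ := max C₁ 0 with hC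
  have hC0 : 0 ≤ C := le_max_right _ _
  set M : ℝ := (2 : ℝ) ^ P * Real.exp (C * |K₀|) / c₀ with hM
  have hbig : ∀ᶠ k in atTop, M < reg.β k := hβ.eventually_gt_atTop M
  obtain ⟨k, ⟨⟨hLk, ⟨ℓ₀, hℓ1, hℓL, hℓa, hOk⟩⟩, hβk⟩⟩ := ((hL.and hO).and hbig).exists
  have ha := reg.a_pos k
  have hℓ : (1 : ℝ) ≤ ℓ₀ := by exact_mod_cast hℓ1
  have h1 := hLk (reg.L k) le_rfl f ℓ₀ hℓL
  have h2 := hOk (reg.L k) le_rfl f (Pi.single 0 (ℓ₀ : ℤ)) (single_mem_box_of_le hℓL)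
    (norm_single_natCast ℓ₀)
  have hB : (0 : ℝ) ≤ 1 + |reg.β k| := by positivity
  rw [← Real.rpow_natCast, ← Real.rpow_natCast] at h2
  have h3 := rpow_le_of_sandwich hc₀ ha hℓ hB h1 h2
  have hqP : P - q ≤ 0 := by linarith
  have hmain : Real.exp (C * (reg.a k * ℓ₀)) * (ℓ₀ : ℝ) ^ (P - q : ℝ) ≤ Real.exp (C * |K₀|) := by
    have e1 : Real.exp (C * (reg.a k * ℓ₀)) ≤ Real.exp (C * |K₀|) := by
      refine Real.exp_le_exp.2 (mul_le_mul_of_nonneg_left ?_ hC0)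
      calc reg.a k * ℓ₀ = (ℓ₀ : ℝ) * reg.a k := mul_comm _ _
        _ ≤ K₀ := hℓa
        _ ≤ |K₀| := le_abs_self _
    have e2 : (ℓ₀ : ℝ) ^ (P - q : ℝ) ≤ 1 := Real.rpow_le_one_of_one_le_of_nonpos hℓ hqP
    calc Real.exp (C * (reg.a k * ℓ₀)) * (ℓ₀ : ℝ) ^ (P - q : ℝ) ≤ Real.exp (C * |K₀|) * 1 :=
        mul_le_mul e1 e2 (by positivity) (Real.exp_pos _).le
      _ = _ := mul_one _
  have h4 : (1 + |reg.β k|) ^ (q : ℝ) ≤ M := by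
    calc (1 + |reg.β k|) ^ (q : ℝ) ≤ (2 : ℝ) ^ P * Real.exp (C * (reg.a k * ℓ₀)) * (ℓ₀ : ℝ) ^ (P - q : ℝ) / c₀ := h3
      _ = (2 : ℝ) ^ P * (Real.exp (C * (reg.a k * ℓ₀)) * (ℓ₀ : ℝ) ^ (P - q : ℝ)) / c₀ := by ring
      _ ≤ (2 : ℝ) ^ P * Real.exp (C * |K₀|) / c₀ :=
          div_le_div_of_nonneg_right (mul_le_mul_of_nonneg_left hmain (by positivity)) hc₀.le
  have h5 : reg.β k ≤ (1 + |reg.β k|) ^ (q : ℝ) :=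
    calc reg.β k ≤ 1 + |reg.β k| := by linarith [le_abs_self (reg.β k)]
      _ ≤ (1 + |reg.β k|) ^ (q : ℝ) :=
          Real.self_le_rpow_of_one_le (by linarith [abs_nonneg (reg.β k)]) (by exact_mod_cast hq)
  linarith

/-- `fm ≥ 0` (a quotient of integrals of non-negative functions). -/
theorem fm_nonneg (β : ℝ) (mq : Fin Nf → ℝ) (S : ℕ) (f : Fin Nf) (v : Site 4) (s : ℝ) :
    0 ≤ fm Nf β mq S f v s := by
  unfold fm
  refine div_nonneg (integral_nonneg fun U => ?_) (integral_nonneg fun U => norm_nonneg _)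
  exact mul_nonneg (norm_nonneg _) (Real.rpow_nonneg (by positivity) _)

/-- `x^{t} ≤ 1 + x` for `x ≥ 0`, `0 ≤ t ≤ 1`. -/
theorem rpow_le_one_add {x t : ℝ} (hx : 0 ≤ x) (ht0 : 0 ≤ t) (ht1 : t ≤ 1) : x ^ t ≤ 1 + x := by
  rcases le_total x 1 with h | h
  · exact (Real.rpow_le_one hx h ht0).trans (by linarith)
  · calc x ^ t ≤ x ^ (1 : ℝ) := Real.rpow_le_rpow_of_exponent_le h ht1
      _ = x := Real.rpow_one x
      _ ≤ 1 + x := by linarith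

/-- `fm` is the phase-quenched expectation `⟨X^s⟩₊` of the tree (`qcdPhaseQuenchedExpect`), `X` the colour–spin
entry sum of the propagator block. -/
theorem fm_eq_expect (β : ℝ) (mq : Fin Nf → ℝ) (S : ℕ) (f : Fin Nf) (v : Site 4) (s : ℝ) :
    fm Nf β mq S f v s = qcdPhaseQuenchedExpect β (2 * S + 1) mq (fun U =>
      (∑ a : Fin 3, ∑ i : Fin 4, ∑ b : Fin 3, ∑ j : Fin 4,
        ‖(diracMatrix U mq)⁻¹ (quarkEquiv (f, (Torus.proj (2 * S + 1) 0, a, i)))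
          (quarkEquiv (f, (Torus.proj (2 * S + 1) v, b, j)))‖) ^ s) := by
  rw [qcdPhaseQuenchedExpect_eq_div]
  rfl

/-- **Lyapunov transfer between exponents** (power means of the phase-quenched PROBABILITY measure are monotone;
Jensen `qcdPhaseQuenchedExpect_jensen_all` with the convex `y ↦ y^{s/s'}`): for `0 < s' ≤ s ≤ 1`,
`fm(s') ≤ fm(s)^{s'/s}`.  So an UPPER bound at exponent `s` (one-scale) descends to every smaller exponent and a
LOWER bound at exponent `s'` ((iii)) ascends to every larger one. -/
theorem fm_le_fm_rpow (β : ℝ) (mq : Fin Nf → ℝ) (S : ℕ) (f : Fin Nf) (v : Site 4) {s s' : ℝ}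
    (hs' : 0 < s') (hss : s' ≤ s) (hs1 : s ≤ 1) :
    fm Nf β mq S f v s' ≤ (fm Nf β mq S f v s) ^ (s' / s) := by
  have hs : 0 < s := hs'.trans_le hss
  set X : GaugeConfig 4 (2 * S + 1) SU3 → ℝ := fun U =>
    ∑ a : Fin 3, ∑ i : Fin 4, ∑ b : Fin 3, ∑ j : Fin 4,
      ‖(diracMatrix U mq)⁻¹ (quarkEquiv (f, (Torus.proj (2 * S + 1) 0, a, i)))
        (quarkEquiv (f, (Torus.proj (2 * S + 1) v, b, j)))‖ with hXdef
  have hX0 : ∀ U, 0 ≤ X U := fun U => by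
    simp only [hXdef]
    positivity
  have hZ := integral_norm_det_diracMatrix_pos_all (S := 2 * S + 1) β mq
  have hXi : Integrable X (qcdLatticeMeasure (2 * S + 1) β mq) :=
    integrable_propagatorEntrySum_qcdLatticeMeasure β mq hZ f _ _
  haveI := isProbabilityMeasure_qcdLatticeMeasure_all (S := 2 * S + 1) β mq
  have hpow : ∀ {t : ℝ}, 0 ≤ t → t ≤ 1 → Integrable (fun U => X U ^ t) (qcdLatticeMeasure (2 * S + 1) β mq) := by
    intro t ht0 ht1
    refine Integrable.mono' ((integrable_const (1 : ℝ)).add hXi)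
      (hXi.aestronglyMeasurable.aemeasurable.pow_const t).aestronglyMeasurable
      (Eventually.of_forall fun U => ?_)
    rw [Real.norm_eq_abs, abs_of_nonneg (Real.rpow_nonneg (hX0 U) _)]
    exact rpow_le_one_add (hX0 U) ht0 ht1
  have e1 : fm Nf β mq S f v s' = qcdPhaseQuenchedExpect β (2 * S + 1) mq (fun U => X U ^ s') := fm_eq_expect ..
  have e2 : fm Nf β mq S f v s = qcdPhaseQuenchedExpect β (2 * S + 1) mq (fun U => X U ^ s) := fm_eq_expect ..
  have hr : 1 ≤ s / s' := by rw [le_div_iff₀ hs']; linarith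
  have hcompf : ((fun y : ℝ => y ^ (s / s')) ∘ fun U => X U ^ s') = fun U => X U ^ s := by
    funext U
    simp only [Function.comp_apply]
    rw [← Real.rpow_mul (hX0 U), mul_div_cancel₀ _ hs'.ne']
  have hJ := qcdPhaseQuenchedExpect_jensen_all (S := 2 * S + 1) β mq (convexOn_rpow hr)
    (Real.continuous_rpow_const (by positivity)).continuousOn isClosed_Ici (fun U => X U ^ s')
    (Eventually.of_forall fun U => Real.rpow_nonneg (hX0 U) _) (hpow hs'.le (hss.trans hs1))
    (by rw [hcompf]; exact hpow hs.le hs1)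
  rw [hcompf] at hJ
  have hA0 : 0 ≤ qcdPhaseQuenchedExpect β (2 * S + 1) mq (fun U => X U ^ s') := by
    rw [qcdPhaseQuenchedExpect_eq_integral_qcdLatticeMeasure]
    exact integral_nonneg fun U => Real.rpow_nonneg (hX0 U) _
  rw [e1, e2]
  have h1 : qcdPhaseQuenchedExpect β (2 * S + 1) mq (fun U => X U ^ s') =
      ((qcdPhaseQuenchedExpect β (2 * S + 1) mq (fun U => X U ^ s')) ^ (s / s')) ^ (s' / s) := by
    rw [← Real.rpow_mul hA0, div_mul_div_comm, mul_comm s s', div_self (by positivity), Real.rpow_one]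
  rw [h1]
  exact Real.rpow_le_rpow (Real.rpow_nonneg hA0 _) hJ (by positivity)

/-- **Shell depth lower bound across exponents.** If (iii) holds at exponent `s₂` and the one-scale matrix at
power `q` holds at a LARGER exponent `s₁ ≥ s₂` (`s₁ ≤ 1`), then — transferring the one-scale bound down to `s₂`
by `fm_le_fm_rpow`, at the real power `r = q s₂/s₁ ≥ 1` — `max C₁ 0 · K₀ > q s₂/s₁ − max p 0`.  So the
common-exponent conclusions (linear growth of `K₀` in `q`, `C₁ > 0`, log room) persist up to the factor `s₂/s₁`
whenever `s_one-scale ≥ s_(iii)`; only a witness with `s_one-scale < s_(iii)` escapes them formally, and then only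
through heavy phase-quenched tails of the propagator modulus on the log-shell (an upper bound on a low moment
with a non-small higher moment). -/
theorem shellDepth_lower_bound_of_exponent_le (reg : QCDRegularisation Nf) (m : Fin Nf → ℝ)
    (hβ : Tendsto reg.β atTop atTop) (f : Fin Nf) {s₁ s₂ c₀ C₁ p K₀ : ℝ} {q : ℕ}
    (hs₂ : 0 < s₂) (hs₂₁ : s₂ ≤ s₁) (hs₁ : s₁ ≤ 1) (hq : s₁ ≤ q * s₂) (hc₀ : 0 < c₀)
    (hL : ∀ᶠ k in atTop, ∀ S : ℕ, reg.L k ≤ S → ∀ (f : Fin Nf) (n : ℕ), n ≤ S →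
      c₀ * Real.exp (-(C₁ * (reg.a k * n) + p * Real.log (n + 1))) ≤
        fm Nf (reg.β k) (bare reg m k) S f (Pi.single 0 (n : ℤ)) s₂)
    (hO : ∀ᶠ k in atTop, ∃ ℓ₀ : ℕ, 1 ≤ ℓ₀ ∧ ℓ₀ ≤ reg.L k ∧
      (ℓ₀ : ℝ) * reg.a k ≤ K₀ * (1 + |Real.log (reg.a k)|) ∧ ∀ S : ℕ, reg.L k ≤ S →
        ∀ (f : Fin Nf) (v : Site 4), v ∈ box 4 S → ‖v‖ = (ℓ₀ : ℝ) →
          (ℓ₀ : ℝ) ^ q * (1 + |reg.β k|) ^ q * fm Nf (reg.β k) (bare reg m k) S f v s₁ ≤ 1) :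
    q * s₂ / s₁ - max p 0 < max C₁ 0 * K₀ := by
  have hs₁0 : 0 < s₁ := hs₂.trans_le hs₂₁
  set t : ℝ := s₂ / s₁ with ht
  have ht0 : 0 < t := div_pos hs₂ hs₁0
  have hr : (1 : ℝ) ≤ q * s₂ / s₁ := by rw [le_div_iff₀ hs₁0, one_mul]; exact hq
  refine shellDepth_lower_bound_rpow reg m hβ f hr hc₀ hL (hO.mono fun k ⟨ℓ₀, h1, h2, h3, h4⟩ => ?_)
  refine ⟨ℓ₀, h1, h2, h3, fun S hS f v hv hn => ?_⟩
  have hℓ : (1 : ℝ) ≤ ℓ₀ := by exact_mod_cast h1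
  have hB : (1 : ℝ) ≤ 1 + |reg.β k| := by linarith [abs_nonneg (reg.β k)]
  set A : ℝ := (ℓ₀ : ℝ) ^ q * (1 + |reg.β k|) ^ q with hA
  have hA1 : 1 ≤ A := one_le_mul_of_one_le_of_one_le (one_le_pow₀ hℓ) (one_le_pow₀ hB)
  have hA0 : 0 < A := by linarith
  -- `fm(s₁) ≤ 1/A`, hence `fm(s₂) ≤ (1/A)^t = A^{-t}`
  have hf1 : fm Nf (reg.β k) (bare reg m k) S f v s₁ ≤ 1 / A := by
    rw [le_div_iff₀' hA0]; exact h4 S hS f v hv hn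
  have hf2 : fm Nf (reg.β k) (bare reg m k) S f v s₂ ≤ A ^ (-t) := by
    calc fm Nf (reg.β k) (bare reg m k) S f v s₂ ≤ (fm Nf (reg.β k) (bare reg m k) S f v s₁) ^ t :=
          fm_le_fm_rpow _ _ _ _ _ hs₂ hs₂₁ hs₁
      _ ≤ (1 / A) ^ t := Real.rpow_le_rpow (fm_nonneg _ _ _ _ _ _) hf1 ht0.le
      _ = A ^ (-t) := by rw [one_div, Real.inv_rpow hA0.le, Real.rpow_neg hA0.le]
  -- `ℓ₀^r B^r = A^t`
  have hpow : (ℓ₀ : ℝ) ^ (q * s₂ / s₁) * (1 + |reg.β k|) ^ (q * s₂ / s₁) = A ^ t := by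
    have e : (q * s₂ / s₁ : ℝ) = (q : ℝ) * t := by rw [ht]; ring
    rw [e, Real.rpow_mul (by linarith), Real.rpow_mul (by linarith), Real.rpow_natCast, Real.rpow_natCast,
      ← Real.mul_rpow (by positivity) (by positivity)]
  rw [hpow]
  calc A ^ t * fm Nf (reg.β k) (bare reg m k) S f v s₂ ≤ A ^ t * A ^ (-t) :=
        mul_le_mul_of_nonneg_left hf2 (Real.rpow_nonneg hA0.le _)
    _ = 1 := by rw [← Real.rpow_add hA0, add_neg_cancel, Real.rpow_zero]

/-- `β_k → +∞` along every body-carrying regularisation with `N_f ≤ 16` (two-loop asymptotic scaling,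
`b₀ > 0`; landed `tendsto_beta_atTop_of_hasAsymptoticScaling`). In particular for `N_f ∈ {2,3}`. -/
theorem tendsto_beta_of_body (hNf : Nf ≤ 16) {reg : QCDRegularisation Nf} (h : Body reg) :
    Tendsto reg.β atTop atTop :=
  Summit.QuantumFields.QCD.Cruxes.WindowExtinction.ChessboardColdCells.tendsto_beta_atTop_of_hasAsymptoticScaling
    hNf reg h.2.2.1

/-- **Crux-level corollary.** In every witness of the crux (`N_f ∈ {2,3}`), for every positive tuple and every
data `(s, c₀, C₁, p)` of (iii): whenever the one-scale clause at power `q ≥ 1` is met with budget `K₀` AT THE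
EXPONENT `s` OF (iii), necessarily `C₁⁺ K₀ > q − p⁺` — the shell depth is tied to the demanded power. -/
theorem body_shellDepth {Nf : ℕ} (hNf : Nf = 2 ∨ Nf = 3) {reg : QCDRegularisation Nf} (h : Body reg)
    (m : Fin Nf → ℝ) {s c₀ C₁ p K₀ : ℝ} {q : ℕ} (hq : 1 ≤ q) (hc₀ : 0 < c₀)
    (hL : ∀ᶠ k in atTop, ∀ S : ℕ, reg.L k ≤ S → ∀ (f : Fin Nf) (n : ℕ), n ≤ S →
      c₀ * Real.exp (-(C₁ * (reg.a k * n) + p * Real.log (n + 1))) ≤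
        fm Nf (reg.β k) (bare reg m k) S f (Pi.single 0 (n : ℤ)) s)
    (hO : ∀ᶠ k in atTop, ∃ ℓ₀ : ℕ, 1 ≤ ℓ₀ ∧ ℓ₀ ≤ reg.L k ∧
      (ℓ₀ : ℝ) * reg.a k ≤ K₀ * (1 + |Real.log (reg.a k)|) ∧ ∀ S : ℕ, reg.L k ≤ S →
        ∀ (f : Fin Nf) (v : Site 4), v ∈ box 4 S → ‖v‖ = (ℓ₀ : ℝ) →
          (ℓ₀ : ℝ) ^ q * (1 + |reg.β k|) ^ q * fm Nf (reg.β k) (bare reg m k) S f v s ≤ 1) :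
    (q : ℝ) - max p 0 < max C₁ 0 * K₀ := by
  have hNf16 : Nf ≤ 16 := by rcases hNf with rfl | rfl <;> norm_num
  have hNf0 : 0 < Nf := by rcases hNf with rfl | rfl <;> norm_num
  exact shellDepth_lower_bound reg m (tendsto_beta_of_body hNf16 h) ⟨0, hNf0⟩ hq hc₀ hL hO


/-! ### §4 The pin inside the `∃ reg`: up-shifts, "package ⇒ chiral", and the shape of the pin inside T -/

/-- The regularisation with its critical mass shifted by the flavour-blind offset `a_k M₀ / Z_m(k)`. -/
def mcritShift (reg : QCDRegularisation Nf) (M₀ : ℝ) : QCDRegularisation Nf :=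
  { reg with mcrit := fun k => reg.mcrit k + reg.a k * M₀ / reg.Zm k }

/-- The bare tuple of the shifted regularisation at `m` is the bare tuple of `reg` at `M₀ + m`. -/
theorem bare_mcritShift (reg : QCDRegularisation Nf) (M₀ : ℝ) (m : Fin Nf → ℝ) (k : ℕ) :
    bare (mcritShift reg M₀) m k = bare reg (fun f => M₀ + m f) k := by
  funext fl
  show reg.mcrit k + reg.a k * M₀ / reg.Zm k + reg.a k * m fl / reg.Zm k = reg.mcrit k + reg.a k * (M₀ + m fl) / reg.Zm k
  ring

/-- Shifting and running at `m` is running `reg` at `M₀ + m` (schemes coincide). -/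
theorem scheme_mcritShift (reg : QCDRegularisation Nf) (M₀ : ℝ) (m : Fin Nf → ℝ) (z shift : QCDField Nf → ℕ → ℝ) :
    (mcritShift reg M₀).scheme m z shift = reg.scheme (fun f => M₀ + m f) z shift := by
  simp only [mcritShift, QCDRegularisation.scheme, QCDScheme.mk.injEq, true_and, and_true]
  funext f k
  ring

/-- Clause (i) transports along the shift. -/
theorem clauseI_mcritShift_iff (reg : QCDRegularisation Nf) (M₀ : ℝ) (m : Fin Nf → ℝ) :
    ClauseI (mcritShift reg M₀) m ↔ ClauseI reg (fun f => M₀ + m f) := by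
  have h : ∀ (k : ℕ) (fl : Fin Nf), reg.mcrit k + reg.a k * M₀ / reg.Zm k + reg.a k * m fl / reg.Zm k =
      reg.mcrit k + reg.a k * (M₀ + m fl) / reg.Zm k := by intros; ring
  simp only [ClauseI, mcritShift, h]

/-- The ONE-SCALE clause transports along the shift (it reads `m` only through the bare tuple). -/
theorem oneScale_mcritShift_iff (reg : QCDRegularisation Nf) (M₀ : ℝ) (m : Fin Nf → ℝ) :
    OneScale (mcritShift reg M₀) m ↔ OneScale reg (fun f => M₀ + m f) := by
  simp only [OneScale, bare_mcritShift]
  rfl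

/-- Clause (iii) transports along the shift. -/
theorem lower_mcritShift_iff (reg : QCDRegularisation Nf) (M₀ : ℝ) (m : Fin Nf → ℝ) :
    Lower (mcritShift reg M₀) m ↔ Lower reg (fun f => M₀ + m f) := by
  simp only [Lower, bare_mcritShift]
  rfl

/-- Clause (iv) transports along the shift. -/
theorem sign_mcritShift_iff (reg : QCDRegularisation Nf) (M₀ : ℝ) (m : Fin Nf → ℝ) :
    Sign (mcritShift reg M₀) m ↔ Sign reg (fun f => M₀ + m f) := by
  simp only [Sign, bare_mcritShift]
  rfl

/-- **The package of the shifted regularisation at `m` is the package of `reg` at `M₀ + m`.** -/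
theorem package_mcritShift_iff (reg : QCDRegularisation Nf) (M₀ : ℝ) (m : Fin Nf → ℝ) :
    Package (mcritShift reg M₀) m ↔ Package reg (fun f => M₀ + m f) := by
  simp only [Package, clauseI_mcritShift_iff, oneScale_mcritShift_iff, lower_mcritShift_iff, sign_mcritShift_iff]

/-- **Everything in the body EXCEPT the pin passes to every up-shift `M₀ ≥ 0`** (the up-shifted copies realise
only quark masses `≥ M₀`): neither scaling nor any of (i), one-scale, (iii), (iv) locates the chiral point. -/
theorem bodyMinusPin_mcritShift (reg : QCDRegularisation Nf) {M₀ : ℝ} (hM₀ : 0 ≤ M₀) (h : BodyMinusPin reg) :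
    BodyMinusPin (mcritShift reg M₀) :=
  ⟨h.1, h.2.1, fun m hm => (package_mcritShift_iff reg M₀ m).2 (h.2.2 _ fun f => by linarith [hm f])⟩

/-- Chirality ABOVE the offset `M₀` (gapless-at-rate-`ε` tuples with all components `> M₀`, for every `ε`). -/
def ChiralAbove (reg : QCDRegularisation Nf) (M₀ : ℝ) : Prop :=
  ∀ ε > (0 : ℝ), ∃ m : Fin Nf → ℝ, (∀ f, M₀ < m f) ∧ ¬ (reg.scheme m 0 0).HasLatticeMassGap ε

/-- `ChiralAbove reg 0` is the pin. -/
theorem chiralAbove_zero_iff (reg : QCDRegularisation Nf) : ChiralAbove reg 0 ↔ reg.IsChiralAtZero := Iff.rfl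

/-- The shifted regularisation is chiral at zero iff the original is chiral above the shift (landed
`RobustYangMillsHandover.Negative.isChiralAtZero_mcrit_shift_iff`, re-bracketed). -/
theorem isChiralAtZero_mcritShift_iff (reg : QCDRegularisation Nf) (M₀ : ℝ) :
    (mcritShift reg M₀).IsChiralAtZero ↔ ChiralAbove reg M₀ := by
  rw [mcritShift,
    Summit.QuantumFields.QCD.Theorems.RobustYangMillsHandover.Negative.isChiralAtZero_mcrit_shift_iff]
  refine forall₂_congr fun ε _ => ⟨fun ⟨m, hm, h⟩ => ⟨fun f => M₀ + m f, fun f => by linarith [hm f], h⟩,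
    fun ⟨m, hm, h⟩ => ⟨fun f => m f - M₀, fun f => by linarith [hm f], ?_⟩⟩
  have : (fun f => M₀ + (m f - M₀)) = m := funext fun f => by ring
  rwa [this]

/-- **The up-shift of a witness is a witness iff the original is chiral above the shift**: the family of
witnesses generated from one witness by up-shifts is truncated exactly by chirality. -/
theorem body_mcritShift_iff_chiralAbove (reg : QCDRegularisation Nf) (h : Body reg) {M₀ : ℝ} (hM₀ : 0 ≤ M₀) :
    Body (mcritShift reg M₀) ↔ ChiralAbove reg M₀ := by
  rw [body_iff, isChiralAtZero_mcritShift_iff]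
  exact ⟨fun h' => h'.2, fun h' => ⟨bodyMinusPin_mcritShift reg hM₀ ((body_iff reg).1 h).1, h'⟩⟩

/-- DOWN-shifts leave the package's domain: the package of `mcritShift reg (−M₀)` at `m` is `reg`'s package at
`m − M₀`, supplied by the body only for `m_f > M₀`. -/
theorem package_mcritShift_neg_iff (reg : QCDRegularisation Nf) (M₀ : ℝ) (m : Fin Nf → ℝ) :
    Package (mcritShift reg (-M₀)) m ↔ Package reg (fun f => m f - M₀) := by
  rw [package_mcritShift_iff]
  have : (fun f => -M₀ + m f) = fun f => m f - M₀ := funext fun f => by ring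
  rw [this]

variable (Nf) in
/-- "The package forces chirality" as a `∀ reg` statement — the separate item the route text warns against
(`∀ reg, HasMassScaling → HasAsymptoticScaling → (∀ m > 0, (i) ∧ one-scale ∧ (iii) ∧ (iv)) → IsChiralAtZero`),
i.e. the foreseen split `MobilityEdgeIsChiralPoint` WITHOUT its minimality hypothesis. -/
def PackageForcesChirality : Prop :=
  ∀ reg : QCDRegularisation Nf, BodyMinusPin reg → reg.IsChiralAtZero

/-- **Certified warning**: `PackageForcesChirality` is EQUIVALENT to "every package-carrying regularisation is
chiral above EVERY offset `M₀ ≥ 0`" (gapless or sign-singular tuples at arbitrarily heavy masses). So the pin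
must ride inside the `∃ reg`, as filed, and any split of the form "package ⇒ chiral" must quantify over
package-MINIMAL regularisations. -/
theorem packageForcesChirality_iff :
    PackageForcesChirality Nf ↔ ∀ reg : QCDRegularisation Nf, BodyMinusPin reg → ∀ M₀ : ℝ, 0 ≤ M₀ → ChiralAbove reg M₀ := by
  constructor
  · intro h reg hB M₀ hM₀
    exact (isChiralAtZero_mcritShift_iff reg M₀).1 (h _ (bodyMinusPin_mcritShift reg hM₀ hB))
  · intro h reg hB
    exact (chiralAbove_zero_iff reg).1 (h reg hB 0 le_rfl)

/-- … hence refuted by any single package-carrying regularisation uniformly gapped above some threshold (the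
expected shape of every honest `OneScaleTrajectory` witness: pions are massive above the chiral point). -/
theorem not_packageForcesChirality_of (reg : QCDRegularisation Nf) (hB : BodyMinusPin reg) {M₀ : ℝ} (hM₀ : 0 ≤ M₀)
    (hgap : ∃ ε > (0 : ℝ), ∀ m : Fin Nf → ℝ, (∀ f, M₀ < m f) → (reg.scheme m 0 0).HasLatticeMassGap ε) :
    ¬ PackageForcesChirality Nf := by
  intro h
  obtain ⟨ε, hε, hg⟩ := hgap
  obtain ⟨m, hm, hn⟩ := (packageForcesChirality_iff.1 h) reg hB M₀ hM₀ ε hε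
  exact hn (hg m hm)

/-- **MINIMALITY, the planner's foreseen split** (`MinimalOneScaleTrajectory → MobilityEdgeIsChiralPoint → T`):
a package-carrying `reg` is MINIMAL when every down-shift by `M₀ > 0` loses the package at some positive tuple.
Unfolded through `package_mcritShift_neg_iff`: minimal ⇔ for every `M₀ > 0` the package of `reg` itself FAILS at
some tuple with all components `> −M₀` (necessarily with a component `≤ 0`, since positive tuples are covered).
Recorded for the planner: (1) minimality is a property of `reg` ALONE (no new object); (2) a down-shift orbit
`{mcritShift reg (−M)}` need not contain a minimal element (if the package of `reg` holds at ALL real tuples the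
orbit has none; if it holds exactly above a threshold not attained, none either) — `MinimalOneScaleTrajectory`
is not a formal consequence of `OneScaleTrajectory`. -/
def PackageMinimal (reg : QCDRegularisation Nf) : Prop :=
  ∀ M₀ > (0 : ℝ), ∃ m : Fin Nf → ℝ, (∀ f, 0 < m f) ∧ ¬ Package (mcritShift reg (-M₀)) m

/-- Minimality unfolded on `reg` itself. -/
theorem packageMinimal_iff (reg : QCDRegularisation Nf) :
    PackageMinimal reg ↔ ∀ M₀ > (0 : ℝ), ∃ m : Fin Nf → ℝ, (∀ f, -M₀ < m f) ∧ ¬ Package reg m := by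
  refine forall₂_congr fun M₀ _ => ⟨fun ⟨m, hm, h⟩ => ⟨fun f => m f - M₀, fun f => by linarith [hm f], ?_⟩,
    fun ⟨m, hm, h⟩ => ⟨fun f => m f + M₀, fun f => by linarith [hm f], ?_⟩⟩
  · rwa [package_mcritShift_neg_iff] at h
  · rw [package_mcritShift_neg_iff]
    have : (fun f => m f + M₀ - M₀) = m := funext fun f => by ring
    rwa [this]

/-- If the package holds at EVERY real tuple, the regularisation is not minimal (and neither is any down-shift of
it: the orbit has no minimal element). Clause (iii) does NOT exclude this — it only pins `|m_f(k)+4| < 41/10`,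
true eventually for every FIXED real tuple since `a_k m_f / Z_m(k) → 0`. -/
theorem not_packageMinimal_of_forall (reg : QCDRegularisation Nf) (h : ∀ m : Fin Nf → ℝ, Package reg m) :
    ¬ PackageMinimal reg := by
  rw [packageMinimal_iff]
  intro hmin
  obtain ⟨m, -, hm⟩ := hmin 1 one_pos
  exact hm (h m)

/-- **The shape of the pin INSIDE T (planner note, not a refutation).** A pin-free witness (`BodyMinusPin`, i.e.
a witness of stmt-11513) whose honest lattice theory has ONE gapless-at-every-rate tuple ANYWHERE (however
heavy or split) is a witness of the chiral crux: the typed pin does not force `m → 0⁺`. -/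
theorem body_of_bodyMinusPin_of_gaplessPoint (reg : QCDRegularisation Nf) (hB : BodyMinusPin reg)
    (h : ∃ m : Fin Nf → ℝ, (∀ f, 0 < m f) ∧ ∀ ε > (0 : ℝ), ¬ (reg.scheme m 0 0).HasLatticeMassGap ε) : Body reg :=
  (body_iff reg).2 ⟨hB, Summit.QuantumFields.QCD.Theorems.ChiralGluonicCompletion.Negative.isChiralAtZero_of_gaplessPoint reg h⟩

/-- … in particular ONE SIGN-BLOW-UP tuple suffices: if some connected correlator of the honest (signed,
`(−1)^F`-twisted) functional at positive masses `m⋆` is unbounded along admissible tori `S ≥ L_k` frequently in `k`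
(the signed partition function nearly vanishing on a torus LARGER than the scheme's own, where (iv) says nothing),
the pin holds with no light pion anywhere (landed `isChiralAtZero_of_blowup`). So `ChiralOneScaleTrajectory` as
typed is ALSO inhabited by "an `OneScaleTrajectory` witness + one sign pathology", and certifies Goldstone physics
only through the downstream `ChiralGluonicCompletion`, whose conclusion `QCDOf` closes the blow-up route
(`qcdOf_witness_noBlowup` in `Cruxes/ChiralGluonicCompletion/Disproof.lean`). For the DISPROVER this makes the crux
harder, not easier, to kill: route 1 must exclude blow-ups too (signed boundedness on all `S ≥ L_k`). -/
theorem body_of_bodyMinusPin_of_blowup (reg : QCDRegularisation Nf) (hB : BodyMinusPin reg)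
    (m : Fin Nf → ℝ) (hm : ∀ f, 0 < m f)
    (h : ∃ (R R' : ℕ) (A : QCDLatticeObservable Nf R) (B : QCDLatticeObservable Nf R'), ∀ C : ℝ, ∃ᶠ k in atTop,
      ∃ S : ℕ, reg.L k ≤ S ∧ ∃ n : ℕ, n ≤ S ∧
        C < ‖qcdLatticeConnectedCorr (reg.β k) (2 * S + 1) (fun fl => reg.mcrit k + reg.a k * m fl / reg.Zm k) A B n‖) :
    Body reg :=
  (body_iff reg).2 ⟨hB, Summit.QuantumFields.QCD.Theorems.ChiralGluonicCompletion.Negative.isChiralAtZero_of_blowup reg m hm h⟩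

/-- The Goldstone (eventual, one-channel) form of the pin also gives the body from a pin-free witness — the
INTENDED reading (`QCDGoldstoneBound.lean`), strictly stronger than the typed pin. -/
theorem body_of_bodyMinusPin_of_goldstone (reg : QCDRegularisation Nf) (hB : BodyMinusPin reg)
    (h : reg.HasGoldstoneBound) : Body reg :=
  (body_iff reg).2 ⟨hB, h.isChiralAtZero⟩

/-- **Near-miss shape for kill route 1 at a given witness** (negative-lemma-modulo-H format): a uniform honest
lattice gap above `0` for `reg` (`H`, the planner's "localisation at a physical rate persisting down to the chiral
line ⇒ honest gap at `0⁺`" AFTER the sign-coherent completion — crux `ChiralGluonicCompletion`'s business, not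
available) refutes the body of `reg`. -/
theorem not_body_of_uniformGap (reg : QCDRegularisation Nf)
    (H : ∃ ε > (0 : ℝ), ∀ m : Fin Nf → ℝ, (∀ f, 0 < m f) → (reg.scheme m 0 0).HasLatticeMassGap ε) : ¬ Body reg :=
  fun h => (Summit.QuantumFields.QCD.Theorems.RobustYangMillsHandover.Negative.not_isChiralAtZero_iff_uniformLatticeGap
    reg).2 H h.2.1

/-! ### §5 Heredity: the body minus the pin passes to subsequences; the pin does so only in Goldstone form -/

/-- **`BodyMinusPin` is hereditary under reindexing** along any `φ → ∞` (all its clauses are `Tendsto` / `∀ᶠ k`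
statements about the data sequences). -/
theorem bodyMinusPin_restrict (reg : QCDRegularisation Nf) (φ : ℕ → ℕ) (hφ : Tendsto φ atTop atTop)
    (h : BodyMinusPin reg) : BodyMinusPin (reg.restrict φ hφ) := by
  obtain ⟨hMS, hAS, hP⟩ := h
  refine ⟨?_, ?_, fun m hm => ?_⟩
  · obtain ⟨c, hc, ht⟩ := hMS
    exact ⟨c, hc, ht.comp hφ⟩
  · obtain ⟨Λ, hΛ, ht⟩ := hAS
    exact ⟨Λ, hΛ, ht.comp hφ⟩
  · obtain ⟨hI, hO, ⟨s, c₀, C₁, p, hs, hs1, hc₀, hL⟩, hIV⟩ := hP m hm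
    refine ⟨fun f => hφ.eventually (hI f), fun q => ?_, ⟨s, c₀, C₁, p, hs, hs1, hc₀, hφ.eventually hL⟩,
      hφ.eventually hIV⟩
    obtain ⟨K₀, s', hs', hs1', hk⟩ := hO q
    exact ⟨K₀, s', hs', hs1', hφ.eventually hk⟩

/-- **With the GOLDSTONE form of the pin the whole body is hereditary** (`HasGoldstoneBound.restrict`). With the
typed pin it is not known to be: `IsChiralAtZero` negates an `∀ᶠ k` clause, i.e. asks violations FREQUENTLY in `k`,
and a `∃ᶠ` property of `reg` need not hold along a given subsequence. Consequence for provers: a witness obtained by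
a diagonal/subsequence construction from approximate witnesses must carry the eventual Goldstone bound
(`QCDRegularisation.HasGoldstoneBound`), not merely the pin. -/
theorem body_restrict_of_goldstone (reg : QCDRegularisation Nf) (φ : ℕ → ℕ) (hφ : Tendsto φ atTop atTop)
    (h : BodyMinusPin reg) (hG : reg.HasGoldstoneBound) : Body (reg.restrict φ hφ) :=
  (body_iff _).2 ⟨bodyMinusPin_restrict reg φ hφ h, hG.isChiralAtZero_restrict φ hφ⟩

/-- The typed pin along a reindexing, unfolded: violations of the gap inequality of `reg` at indices `φ t` for
infinitely many `t` — data about `reg` ALONG `φ`, not selectable from the pin of `reg`. -/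
theorem isChiralAtZero_restrict_iff (reg : QCDRegularisation Nf) (φ : ℕ → ℕ) (hφ : Tendsto φ atTop atTop) :
    (reg.restrict φ hφ).IsChiralAtZero ↔ ∀ ε > (0 : ℝ), ∃ m : Fin Nf → ℝ, (∀ f, 0 < m f) ∧
      ∃ (R R' : ℕ) (A : QCDLatticeObservable Nf R) (B : QCDLatticeObservable Nf R'), ∀ C : ℝ,
        ∃ᶠ t in atTop, ∃ S : ℕ, reg.L (φ t) ≤ S ∧ ∃ n : ℕ, n ≤ S ∧
          C * Real.exp (-(ε * (reg.a (φ t) * n))) <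
            ‖qcdLatticeConnectedCorr (reg.β (φ t)) (2 * S + 1)
              (fun fl => reg.mcrit (φ t) + reg.a (φ t) * m fl / reg.Zm (φ t)) A B n‖ := by
  unfold QCDRegularisation.IsChiralAtZero QCDScheme.HasLatticeMassGap
  simp only [not_forall, not_exists, Filter.not_eventually, not_le, exists_prop, gt_iff_lt]
  rfl

/-! ### §6 Why the crux resists a cheap kill — attack record, near-misses, what was NOT done (cycle 1)

ATTACKS (all negative):
1. ELABORATION / READ-BACK (`W.lean` rc 0): `chiralOneScaleTrajectory_iff` is `Iff.rfl` against the landed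
   `LowerPin` vocabulary; no junk operator bites (positive denominators, total `Matrix.inv` under weight `|det| = 0`,
   `‖·‖∞` on `Fin 4 → ℤ`, `Real.rpow` with non-negative base; the pin is `QCDOf`'s constant verbatim).
2. VACUITY / TRIVIALITY: the body is neither junk-inhabited (`not_body_heavyReg`: (iii) kills the lattice-heavy
   witness that carries everything else, `withoutLowerAndPin_holds`) nor junk-refutable (`not_iff`: `¬T` is a
   universal non-existence statement over `QCDRegularisation N_f`).  Degenerate flavour numbers are excluded by
   `N_f ∈ {2,3}` (the `N_f = 0` flank of the pin, `not_qcdOf_zero`, does not enter).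
3. CLAUSE-INTERNAL INCONSISTENCY (the `MultibosonLatticeGap` pattern: a clause false for EVERY scheme): none.
   (i), one-scale, (iv) are jointly inhabited by `heavyReg`; (iii) alone is inhabited at `n ∈ {0,1}` by the tree's
   diagonal/neighbourhood propagator lower bounds and is open beyond; the pin alone is neither provable nor
   refutable for any regularisation in the tree (`noChiralAFReg_iff`: its negation is a uniform honest gap).
   The only formal meeting point of two clauses is one-scale ∧ (iii) on the time axis — exploited in §3: it yields
   TIGHTNESS (shell depth linear in `q`, `C₁ > 0`, log room), not falsity, because the log room is exactly enough.
4. HYPOTHESIS MUTATION: drop the pin ⇒ stmt-11513 (open, (iii) its sole pin); drop (iii) ⇒ `ChiralAFReg`-hard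
   (§2d); drop both ⇒ provable (§2a); drop `HasMassScaling` ⇒ runaway-`Z_m` collapse is still blocked by (iii)
   (bare masses must stay light: `body_window`); drop asymptotic scaling ⇒ §3 loses `β_k → ∞` and frozen-glue
   witnesses (`β_k` bounded) re-enter — AS is load-bearing for §3 and for the physics alike; commute `∀ q ∃ K₀`
   ⇒ refuted (§3); delete the log factor ⇒ refuted (§3); `(iii)` with `C₁ ≤ 0` ⇒ refuted (§3); "package ⇒ chiral"
   as a `∀ reg` item ⇒ equivalent to chirality above every threshold (§4), dead under any uniform gap above a
   threshold; pin in Goldstone/eventual form ⇒ hereditary (§5), typed pin ⇒ not known to be.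
5. PIN VERSUS PACKAGE (the new conjunct): no tree lemma links `qcdLatticeConnectedCorr` (honest, signed,
   `(−1)^F`-twisted ratio functional) to the `|det|`-tilted fractional moments of one-scale/(iii) or to the sign
   ratio of (iv), EXCEPT at `N_f = 2` with degenerate masses (`det² ≥ 0`: honest = phase-quenched), where
   Wick + `γ₅`-hermiticity + Jensen turn (iii) into a pion-channel LOWER bound at rate `2C₁(t)/s(t)` (sibling card
   `Cruxes/ChiralMobilityGap/Ideas/pin-rides-on-lower-clause.md`).  That is SUPPORT for the pin, not tension: it is
   consistent with T iff `C₁(t)/s(t)` may tend to `0` as `t → 0⁺`, which T permits (all constants are per-`m`;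
   §3 only ties `K₀(q,t) ≳ q/C₁(t)`, also permitted).  Conversely the one-scale UPPER bound controls one shell of
   one functional and says nothing about glueball or baryon channels, so it cannot force an honest gap.
6. SMALL MODELS / COMPUTE: nothing submitted — every clause is asymptotic (`∃ reg ∀ᶠ k ∀ S ≥ L_k`), no finite
   computation yields a certificate either way (compute discipline).  The 11513 ideators' toys (kit j019452,
   j019462, j019184: 4⁴–6⁴ `SU(3)`, real modes of `D_W`, Bochner identity) are evidence on stmt-11513 and do not
   bear on the pin.
7. LITERATURE (search degraded this session: local searchd reset, arXiv/OpenAlex/S2 HTTP 429; galaxy pdf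
   substring "mobility edge" 40 rows, relevant: Golterman–Shamir(–Svetitsky) mobility-edge picture of the Aoki
   phase [GoltermanShamir2003; PRD 71 (2005) 071502; PRD 72 (2005) 034501] — the edge reaches `0` AT the Aoki
   boundary with localised in-gap modes outside, i.e. the physics FAVOURS a witness tuned onto the boundary;
   Alexandru–Horváth PRD 109 (2024) 014501 (localised low modes in the IR phase — high temperature, not here);
   RBC/UKQCD arXiv:1208.4412 (mobility edge of `H_W` as the DWF residual-mass control)).  No printed no-go of the
   form "physical-rate localisation of the phase-quenched propagator persists down to the chiral line"; rigorous
   chiral symmetry breaking exists only for staggered fermions at strong coupling (Salmhofer–Seiler, CMP 139 (1991)).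
   Barriers (`Literature/Barriers/QuantumFields/`): AokiPhaseDichotomy — location reading, not blocked (the
   trajectory is `a_k → 0`, `∀ᶠ k`); WilsonDeterminantSign / …MassSplitting — met through (iv), not evaded
   (unchanged from 9150/11513); GoldstoneTheorem — what the pin imports, consistent; BanksCasher /
   VafaWittenEigenvalueBound — support the pin's physics, do not bite the per-`m` package.  Negatives index
   (4 entries: MirrorModularBoosts RP, AdaptiveCoarseSystem, two MultibosonBridge) shares no mechanism.

NEAR-MISSES, typed for a second cycle (negative-lemma-modulo-H format, all PROVED as implications here):
* `not_body_of_uniformGap reg H` — kill route 1 at a given witness needs `H` = a uniform honest lattice gap above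
  `m = 0` for THAT `reg` (glue included): not constructible.
* `not_pin_heavyReg_of_gap H` — even the junk witness's non-chirality needs the heavy-quark + glue lattice gap.
* kill route 2 would need `DefectFloor`-type lower bounds (sibling `Cruxes/MobilityGap/Disproof.lean` §6) on the
  interacting measure AT the approach to the witness's own critical line, for every admissible `(β_k, L_k, m_crit)`.

HANDOFF FOR PROVERS (what this file certifies you must do): keep the quarks light ((iii) ⇒ `limsup m_crit(k) ≤ 0`,
`Negative/CriticalMassLimsup.lean`; with (i): bare masses accumulate in `[−1, 0]`; (iv) is free by Seiler positivity only
if ALL realised bare masses stay positive, i.e. `m_crit(k) ≥ 0` along the way — allowed by `limsup ≤ 0` (e.g.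
`m_crit ≡ 0`) but physically dead, since the interacting critical line sits at `m_c(β_k) ≍ −g₀² < 0` with
`|m_c| ≫ a_k`, where bare mass `0⁺` is physically infinitely heavy and (iii) fails — NOT certified: a rigorous
`m_c(β) ≤ −c g₀²` is the missing negative lemma that would make (iv) contentful on every witness);
put the one-scale shell at depth `K₀(q) ≳ (q − p)/C₁` logs with `C₁ > 0` (§3), or separate the exponents
`s_one-scale < s_(iii)`; take the physical volume superlogarithmic, `a_k L_k / log(1/a_k) → ∞` (necessary by
`Negative/VolumeGrowth.lean`, sufficient modulo (ii) by `oneScale_of_upper`) and prove (iv) at THAT volume; prove the pin for the SAME `reg` — cheapest honest route at `N_f = 2`: degenerate masses,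
(iii) with `C₁(t)/s(t) → 0`, Wick–`γ₅`–Jensen; at `N_f = 3` a sign input at one volume per `k` is needed on top;
and if your witness comes from a subsequence/diagonal construction, carry `HasGoldstoneBound`, not the pin (§5).
-/

end Summit.QuantumFields.QCD.Cruxes.ChiralOneScaleTrajectory.Disproof

end
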